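import Literature.Analysis.FunctionSpaces.FourierSobolevNormEmbeddingProofs
import Mathlib.Analysis.SpecialFunctions.JapaneseBracket
import HarnessLib

/-!
# The Sobolev embedding `H^s(ℝᵈ) ⊂ L^∞` for `s > d/2`, Fourier side, for `L²` classes

Analysis/FunctionSpaces support file (theorems only; no definitions, no named facts). For the tree's
Fourier-side inhomogeneous Sobolev norm `eFourierSobolevNorm s f = (∫ (1+‖ξ‖²)^s ‖𝓕f(ξ)‖² dξ)^{1/2}` of an
`L²` class `f : Lp F 2` on a finite-dimensional real inner product space `E` (`d = dim E`, `F` a complex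
Hilbert space) and its function-level wrapper `Function.eSobolevNorm` (`FourierSobolevNorm.lean`), the
classical Sobolev lemma in its quantitative `L^∞` form (Folland, *Introduction to PDE*, 2nd ed., §6.A,
Theorem (6.5) «If `s > k + ½n`, then `H_s ⊂ C^k`», case `k = 0`, and its proof; Bahouri–Chemin–Danchin
2011, Thm. 1.66 / §1.4.1): for `2s > d`,

  `‖f‖_{L^∞} ≤ ‖𝓕f‖_{L¹} ≤ C_s ‖f‖_{H^s}`,  `C_s = (∫ (1+‖ξ‖²)^{-s} dξ)^{1/2} < ∞`.

* `lintegral_bessel_rpow_neg_lt_top` — `∫ (1+‖ξ‖²)^{-s} dξ < ∞` for `d < 2s` (Mathlib's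
  `integrable_rpow_neg_one_add_norm_sq`, `ℝ≥0∞` form);
* `lintegral_enorm_fourier_le_mul_eFourierSobolevNorm` — Cauchy–Schwarz:
  `∫ ‖𝓕f‖ ≤ C_s · ‖f‖_{H^s}` (any real `s`; both sides may be `∞`);
* `ae_enorm_le_lintegral_enorm_fourier` — Fourier inversion for `L²` classes with `𝓕f ∈ L¹`:
  `‖f(x)‖ ≤ ∫ ‖𝓕f‖` for a.e. `x` (the tree's frequency splitting
  `SobolevEmbeddingHalf.exists_high_frequency_part` with the whole frequency space as the low part);
* `ae_enorm_le_mul_eFourierSobolevNorm`, **`ae_enorm_le_mul_eSobolevNorm`** — the embedding: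
  `‖g(x)‖ ≤ C_s ‖g‖_{H^s}` for a.e. `x`, for every `g : E → F` when `d < 2s` (trivial when `‖g‖_{H^s} = ∞`).

The a.e. form is what the consumers need (Serrin-class membership `L^∞_t L^∞_x` of `H^s`-valued
classical solutions, `s > 3/2`, e.g. claim C152 `PinheiroQueiroz2025` of the cell `ns-claims`); for a
continuous `g` the bound holds everywhere (closed full-measure sets of an open-positive measure are
everything), which is left to the consumer.

## Mathlib / tree search
Mathlib (this pin): `MemSobolev` (Bessel potential spaces, `Mathlib/Analysis/Distribution/Sobolev.lean`)
has no embedding theorems; `integrable_rpow_neg_one_add_norm_sq` (Japanese bracket) and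
`ENNReal.lintegral_mul_le_Lp_mul_Lq` (Hölder) are used. Tree: `SobolevFourierEmbedding.lean` proves the
Sobolev lemma `H^s ⊂ C^k` for CONTINUOUS COMPACTLY SUPPORTED scalar `f ∈ L¹ ∩ L²` via the `L¹` Fourier
integral (`contDiff_of_memSobolev_fnTD`, `integrable_fourier_of_memLp_besselWeight`) — not applicable to a
general `L²` class; `FourierSobolevNormEmbeddingProofs.lean` proves the SUBCRITICAL `Ḣ^{1/2} ⊂ L³` and
supplies the `L²`-class inversion tools reused here; `SobolevImbeddingSup.lean` is the physical-side
`H² ⊂ C_B` in dimension three (integer order, `iteratedFDeriv`).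

## References
* G. B. Folland, *Introduction to Partial Differential Equations*, 2nd ed. (1995), §6.A, Theorem (6.5)
  and its proof. [Folland1995PDE]
* H. Bahouri, J.-Y. Chemin, R. Danchin, *Fourier Analysis and Nonlinear PDE*, Springer (2011), §1.4.1.
  [BahouriCheminDanchin2011]
-/

noncomputable section

open MeasureTheory FourierTransform Set Filter Module
open scoped ENNReal NNReal Topology

namespace Literature.Analysis.FunctionSpaces

variable {E : Type*} [NormedAddCommGroup E] [InnerProductSpace ℝ E] [FiniteDimensional ℝ E]
  [MeasurableSpace E] [BorelSpace E]
variable {F : Type*} [NormedAddCommGroup F] [InnerProductSpace ℂ F] [CompleteSpace F]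

omit [InnerProductSpace ℝ E] [FiniteDimensional ℝ E] [MeasurableSpace E] [BorelSpace E] in
/-- Measurability of the Bessel weight `ξ ↦ (1 + ‖ξ‖²)^a` (it is continuous). [folklore] -/
private theorem continuous_bessel_rpow (a : ℝ) : Continuous fun ξ : E => (1 + ‖ξ‖ ^ 2) ^ a := by
  refine Continuous.rpow_const (by fun_prop) fun ξ => Or.inl ?_
  positivity

/-- **`∫ (1 + ‖ξ‖²)^{-s} dξ < ∞` for `d < 2s`** (Folland, proof of Theorem (6.5); Mathlib's
`integrable_rpow_neg_one_add_norm_sq` in `ℝ≥0∞` form). [cite: Folland1995PDE, §6.A Theorem (6.5) (proof)] -/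
theorem lintegral_bessel_rpow_neg_lt_top {s : ℝ} (hs : (finrank ℝ E : ℝ) < 2 * s) :
    ∫⁻ ξ : E, ENNReal.ofReal ((1 + ‖ξ‖ ^ 2) ^ (-s)) < ⊤ := by
  have hi := (integrable_rpow_neg_one_add_norm_sq (E := E) (μ := (volume : Measure E)) hs).hasFiniteIntegral
  rw [hasFiniteIntegral_iff_enorm] at hi
  refine lt_of_le_of_lt (le_of_eq (lintegral_congr fun ξ => ?_)) hi
  rw [show (-(2 * s) / 2 : ℝ) = -s by ring, Real.enorm_eq_ofReal (Real.rpow_nonneg (by positivity) _)]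

/-- `C_s = (∫ (1 + ‖ξ‖²)^{-s} dξ)^{1/2}` is finite for `d < 2s`. [cite: Folland1995PDE, §6.A Theorem (6.5) (proof)] -/
theorem bessel_const_lt_top {s : ℝ} (hs : (finrank ℝ E : ℝ) < 2 * s) :
    (∫⁻ ξ : E, ENNReal.ofReal ((1 + ‖ξ‖ ^ 2) ^ (-s))) ^ (1 / 2 : ℝ) < ⊤ :=
  ENNReal.rpow_lt_top_of_nonneg (by norm_num) (lintegral_bessel_rpow_neg_lt_top hs).ne

/-- `C_s = (∫ (1 + ‖ξ‖²)^{-s} dξ)^{1/2}` is nonzero (the weight is positive and Lebesgue measure is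
positive on open sets). [folklore] -/
private theorem bessel_const_ne_zero (s : ℝ) :
    (∫⁻ ξ : E, ENNReal.ofReal ((1 + ‖ξ‖ ^ 2) ^ (-s))) ^ (1 / 2 : ℝ) ≠ 0 := by
  have hpos : 0 < ∫⁻ ξ : E, ENNReal.ofReal ((1 + ‖ξ‖ ^ 2) ^ (-s)) := by
    rw [lintegral_pos_iff_support ((continuous_bessel_rpow (-s)).measurable.ennreal_ofReal)]
    have hsupp : Function.support (fun ξ : E => ENNReal.ofReal ((1 + ‖ξ‖ ^ 2) ^ (-s))) = univ := by
      refine eq_univ_of_forall fun ξ => ?_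
      rw [Function.mem_support]
      exact (ENNReal.ofReal_pos.2 (Real.rpow_pos_of_pos (by positivity) _)).ne'
    rw [hsupp]
    exact isOpen_univ.measure_pos volume univ_nonempty
  exact (ENNReal.rpow_pos_of_nonneg hpos (by norm_num)).ne'

/-- **Cauchy–Schwarz on the Fourier side**: `∫ ‖𝓕f‖ ≤ (∫ (1+‖ξ‖²)^{-s})^{1/2} · ‖f‖_{H^s}` for every
`L²` class `f` and every real `s` (Folland, proof of Theorem (6.5): `∫|f̂| = ∫ ⟨ξ⟩^{-s}·⟨ξ⟩^{s}|f̂| ≤ …`).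
[cite: Folland1995PDE, §6.A Theorem (6.5) (proof)] -/
theorem lintegral_enorm_fourier_le_mul_eFourierSobolevNorm (s : ℝ) (f : Lp F 2 (volume : Measure E)) :
    ∫⁻ ξ, ‖((𝓕 f : Lp F 2 (volume : Measure E)) : E → F) ξ‖ₑ ≤
      (∫⁻ ξ : E, ENNReal.ofReal ((1 + ‖ξ‖ ^ 2) ^ (-s))) ^ (1 / 2 : ℝ) * eFourierSobolevNorm s f := by
  set G : E → F := ((𝓕 f : Lp F 2 (volume : Measure E)) : E → F) with hG
  have hGm : AEStronglyMeasurable G volume := Lp.aestronglyMeasurable _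
  set a : E → ℝ≥0∞ := fun ξ => ENNReal.ofReal ((1 + ‖ξ‖ ^ 2) ^ (-s / 2)) with ha
  set b : E → ℝ≥0∞ := fun ξ => ENNReal.ofReal ((1 + ‖ξ‖ ^ 2) ^ (s / 2)) * ‖G ξ‖ₑ with hb
  have h0 : ∀ ξ : E, (0 : ℝ) < 1 + ‖ξ‖ ^ 2 := fun ξ => by positivity
  have hab : ∀ ξ, ‖G ξ‖ₑ = (a * b) ξ := by
    intro ξ
    simp only [Pi.mul_apply, ha, hb]
    rw [← mul_assoc, ← ENNReal.ofReal_mul (Real.rpow_nonneg (h0 ξ).le _), ← Real.rpow_add (h0 ξ),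
      show -s / 2 + s / 2 = (0 : ℝ) by ring, Real.rpow_zero, ENNReal.ofReal_one, one_mul]
  have ham : AEMeasurable a volume := (continuous_bessel_rpow (-s / 2)).measurable.ennreal_ofReal.aemeasurable
  have hbm : AEMeasurable b volume :=
    (continuous_bessel_rpow (s / 2)).measurable.ennreal_ofReal.aemeasurable.mul hGm.enorm
  have ha2 : ∀ ξ, a ξ ^ (2 : ℝ) = ENNReal.ofReal ((1 + ‖ξ‖ ^ 2) ^ (-s)) := by
    intro ξ
    simp only [ha]
    rw [ENNReal.ofReal_rpow_of_nonneg (Real.rpow_nonneg (h0 ξ).le _) (by norm_num),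
      ← Real.rpow_mul (h0 ξ).le]
    congr 2
    ring
  have hb2 : ∀ ξ, b ξ ^ (2 : ℝ) = ENNReal.ofReal ((1 + ‖ξ‖ ^ 2) ^ s) * ‖G ξ‖ₑ ^ 2 := by
    intro ξ
    simp only [hb]
    rw [ENNReal.mul_rpow_of_nonneg _ _ (by norm_num : (0 : ℝ) ≤ 2),
      ENNReal.ofReal_rpow_of_nonneg (Real.rpow_nonneg (h0 ξ).le _) (by norm_num),
      ← Real.rpow_mul (h0 ξ).le, ENNReal.rpow_two]
    congr 3
    ring
  calc ∫⁻ ξ, ‖G ξ‖ₑ = ∫⁻ ξ, (a * b) ξ := lintegral_congr hab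
    _ ≤ (∫⁻ ξ, a ξ ^ (2 : ℝ)) ^ (1 / (2 : ℝ)) * (∫⁻ ξ, b ξ ^ (2 : ℝ)) ^ (1 / (2 : ℝ)) :=
        ENNReal.lintegral_mul_le_Lp_mul_Lq volume Real.HolderConjugate.two_two ham hbm
    _ = (∫⁻ ξ : E, ENNReal.ofReal ((1 + ‖ξ‖ ^ 2) ^ (-s))) ^ (1 / 2 : ℝ) * eFourierSobolevNorm s f := by
        unfold eFourierSobolevNorm
        rw [lintegral_congr ha2, lintegral_congr hb2]

/-- **Fourier inversion bound for `L²` classes**: if `𝓕f ∈ L¹` then `‖f(x)‖ ≤ ∫ ‖𝓕f‖` for a.e. `x`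
(Folland, proof of Theorem (6.5), «f is the inverse Fourier transform of f̂ ∈ L¹»; realised through the
tree's frequency splitting `SobolevEmbeddingHalf.exists_high_frequency_part` with low part = everything,
so that the high-frequency remainder has `∫‖·‖² = 0`). [cite: Folland1995PDE, §6.A Theorem (6.5) (proof)] -/
theorem ae_enorm_le_lintegral_enorm_fourier (f : Lp F 2 (volume : Measure E))
    (hG : ∫⁻ ξ, ‖((𝓕 f : Lp F 2 (volume : Measure E)) : E → F) ξ‖ₑ < ⊤) :
    ∀ᵐ x ∂(volume : Measure E),
      ‖(f : E → F) x‖ₑ ≤ ∫⁻ ξ, ‖((𝓕 f : Lp F 2 (volume : Measure E)) : E → F) ξ‖ₑ := by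
  have hGs : ∫⁻ ξ in univ, ‖((𝓕 f : Lp F 2 (volume : Measure E)) : E → F) ξ‖ₑ < ⊤ := by
    rwa [Measure.restrict_univ]
  obtain ⟨fh, hfhm, hfh2, hae⟩ :=
    SobolevEmbeddingHalf.exists_high_frequency_part f MeasurableSet.univ hGs
  have h0 : ∫⁻ x, ‖fh x‖ₑ ^ 2 = 0 := by
    rw [hfh2, compl_univ, Measure.restrict_empty, lintegral_zero_measure]
  have hfh0 : ∀ᵐ x ∂(volume : Measure E), ‖fh x‖ₑ = 0 := by
    have h := (lintegral_eq_zero_iff' (hfhm.enorm.pow_const 2)).1 h0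
    filter_upwards [h] with x hx
    simpa using hx
  filter_upwards [hae, hfh0] with x hx hx0
  rw [hx0, add_zero, Measure.restrict_univ] at hx
  exact hx

/-- **`H^s ⊂ L^∞`, `L²`-class form**: for `d < 2s` and every `L²` class `f`,
`‖f(x)‖ ≤ C_s ‖f‖_{H^s}` for a.e. `x`, `C_s = (∫ (1+‖ξ‖²)^{-s})^{1/2}` (Folland, Theorem (6.5) with `k = 0`;
Bahouri–Chemin–Danchin 2011, §1.4.1). [cite: Folland1995PDE, §6.A Theorem (6.5)] -/
theorem ae_enorm_le_mul_eFourierSobolevNorm {s : ℝ} (hs : (finrank ℝ E : ℝ) < 2 * s)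
    (f : Lp F 2 (volume : Measure E)) :
    ∀ᵐ x ∂(volume : Measure E), ‖(f : E → F) x‖ₑ ≤
      (∫⁻ ξ : E, ENNReal.ofReal ((1 + ‖ξ‖ ^ 2) ^ (-s))) ^ (1 / 2 : ℝ) * eFourierSobolevNorm s f := by
  by_cases htop : eFourierSobolevNorm s f = ⊤
  · rw [htop, ENNReal.mul_top (bessel_const_ne_zero s)]
    exact Eventually.of_forall fun _ => le_top
  have hle := lintegral_enorm_fourier_le_mul_eFourierSobolevNorm s f
  have hfin : ∫⁻ ξ, ‖((𝓕 f : Lp F 2 (volume : Measure E)) : E → F) ξ‖ₑ < ⊤ :=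
    lt_of_le_of_lt hle (ENNReal.mul_lt_top (bessel_const_lt_top hs) (lt_top_iff_ne_top.2 htop))
  filter_upwards [ae_enorm_le_lintegral_enorm_fourier f hfin] with x hx
  exact hx.trans hle

/-- **`H^s ⊂ L^∞`, function-level form**: for `d < 2s` and every `g : E → F`,
`‖g(x)‖ ≤ C_s ‖g‖_{H^s}` for a.e. `x` with the tree's `Function.eSobolevNorm` (`∞` off `L²`, where the
bound is trivial). [cite: Folland1995PDE, §6.A Theorem (6.5)] [cite: BahouriCheminDanchin2011, §1.4.1] -/
theorem ae_enorm_le_mul_eSobolevNorm {s : ℝ} (hs : (finrank ℝ E : ℝ) < 2 * s) (g : E → F) :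
    ∀ᵐ x ∂(volume : Measure E), ‖g x‖ₑ ≤
      (∫⁻ ξ : E, ENNReal.ofReal ((1 + ‖ξ‖ ^ 2) ^ (-s))) ^ (1 / 2 : ℝ) * Function.eSobolevNorm s g := by
  unfold Function.eSobolevNorm
  split_ifs with h
  · filter_upwards [ae_enorm_le_mul_eFourierSobolevNorm hs (h.toLp g), h.coeFn_toLp] with x hx hgx
    rw [← hgx]
    exact hx
  · rw [ENNReal.mul_top (bessel_const_ne_zero s)]
    exact Eventually.of_forall fun _ => le_top

/-! ### Rev 2 (append-only): `L^∞`-norm and everywhere forms -/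

/-- **`H^s ⊂ L^∞`, norm form for `L²` classes**: `‖f‖_{L^∞} ≤ C_s ‖f‖_{H^s}` for `d < 2s`
(Folland, Theorem (6.5); the essential supremum of the a.e. bound `ae_enorm_le_mul_eFourierSobolevNorm`).
[cite: Folland1995PDE, §6.A Theorem (6.5)] -/
theorem eLpNorm_top_le_mul_eFourierSobolevNorm {s : ℝ} (hs : (finrank ℝ E : ℝ) < 2 * s)
    (f : Lp F 2 (volume : Measure E)) :
    eLpNorm (f : E → F) ⊤ volume ≤
      (∫⁻ ξ : E, ENNReal.ofReal ((1 + ‖ξ‖ ^ 2) ^ (-s))) ^ (1 / 2 : ℝ) * eFourierSobolevNorm s f := by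
  rw [eLpNorm_exponent_top]
  exact eLpNormEssSup_le_of_ae_enorm_bound (ae_enorm_le_mul_eFourierSobolevNorm hs f)

/-- **`H^s ⊂ L^∞`, norm form for functions**: `‖g‖_{L^∞} ≤ C_s ‖g‖_{H^s}` for `d < 2s`, with the tree's
`Function.eSobolevNorm` (`∞` off `L²`). [cite: Folland1995PDE, §6.A Theorem (6.5)] [cite: BahouriCheminDanchin2011, §1.4.1] -/
theorem eLpNorm_top_le_mul_eSobolevNorm {s : ℝ} (hs : (finrank ℝ E : ℝ) < 2 * s) (g : E → F) :
    eLpNorm g ⊤ volume ≤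
      (∫⁻ ξ : E, ENNReal.ofReal ((1 + ‖ξ‖ ^ 2) ^ (-s))) ^ (1 / 2 : ℝ) * Function.eSobolevNorm s g := by
  rw [eLpNorm_exponent_top]
  exact eLpNormEssSup_le_of_ae_enorm_bound (ae_enorm_le_mul_eSobolevNorm hs g)

/-- **`H^s ⊂ L^∞` for CONTINUOUS functions, everywhere**: for `d < 2s` and a continuous `g : E → F`,
`‖g(x)‖ ≤ C_s ‖g‖_{H^s}` at EVERY `x` — the a.e. bound upgrades because `{x | C_s‖g‖_{H^s} < ‖g x‖}` is
open and Lebesgue-null, hence empty (Haar measure is positive on nonempty open sets). This is the form in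
which `H^s ⊂ C_B` (Folland, Theorem (6.5): «H_s ⊂ C^k», k = 0) is usually quoted.
[cite: Folland1995PDE, §6.A Theorem (6.5)] -/
theorem _root_.Continuous.enorm_le_mul_eSobolevNorm {s : ℝ} (hs : (finrank ℝ E : ℝ) < 2 * s) {g : E → F}
    (hg : Continuous g) (x : E) :
    ‖g x‖ₑ ≤ (∫⁻ ξ : E, ENNReal.ofReal ((1 + ‖ξ‖ ^ 2) ^ (-s))) ^ (1 / 2 : ℝ) * Function.eSobolevNorm s g := by
  set C : ℝ≥0∞ := (∫⁻ ξ : E, ENNReal.ofReal ((1 + ‖ξ‖ ^ 2) ^ (-s))) ^ (1 / 2 : ℝ) *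
    Function.eSobolevNorm s g with hC
  by_contra hx
  rw [not_le] at hx
  have hopen : IsOpen {y : E | C < ‖g y‖ₑ} := isOpen_lt continuous_const hg.enorm
  have hpos : 0 < volume {y : E | C < ‖g y‖ₑ} := hopen.measure_pos volume ⟨x, hx⟩
  have hzero : volume {y : E | C < ‖g y‖ₑ} = 0 := by
    have h := ae_enorm_le_mul_eSobolevNorm hs g
    rw [ae_iff] at h
    simpa only [not_le] using h
  exact hpos.ne' hzero

end Literature.Analysis.FunctionSpaces
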